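import Summits.CriticalPhenomena.SAWScalingLimit.Theses.SAWBrickWallHomotopy
import Literature.Probability.RandomPlanarGeometry.SAWBrickWallHex
import HarnessLib

/-!
# `ModulusUniversality`, line `birth`: stub A is the route crux `BrickWallFlow` at `t = 0`

Helper file (`--supports stmt-CriticalPhenomena-5790`) of the line `birth` / `registered` for the crux
`SAWBrickWallHomotopy.ModulusUniversality` (skeleton
`Summits/CriticalPhenomena/SAWScalingLimit/Cruxes/ModulusUniversality/Lines/birth.lean`, lead reshape 1:
stubs phrased over the tree's `SAW.brickWallLaw Ω δ t a b` of `SAWBrickWall.lean`).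

The registered stub A `stub_brickWallComparison` reads: there are `ρ₁, ρ₂ > 0` such that for the
diagonal homeomorphism `Ψ = diag(ρ₁, ρ₂)`, every Dobrushin domain `D` and every `ℤ²` endpoint
approximation `(a, b)` of `D`, some `ℤ²` endpoint approximation `(a', b')` of `Ψ⁻¹ D` carries an eventually
genuine critical brick-wall law `SAW.brickWallLaw (Ψ⁻¹D) δ 0 (a' δ) (b' δ)` (weight
`x_c(0)^{|γ|} 0^{N_odd(γ)}`: the honeycomb fugacity `x_c(0) = 1/√(2+√2)` on brick-wall = honeycomb walks,
`SAW.criticalFugacityT_zero`, and `0` elsewhere) whose `Ψ`-image merges with the critical `ℤ²` SAW law of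
`D` on bounded continuous test functions of the curve.

**This is, definitionally, the instance `t = 0` of the route crux `BrickWallFlow`**
(stmt-CriticalPhenomena-5791): the `let`-bound `nodd`, `xc`, `P` of that item are literally the bodies of
`SAW.oddVerticalCount`, `SAW.criticalFugacityT`, `SAW.brickWallLaw` (module docstring of
`SAWBrickWall.lean`), so `BrickWallFlow 0 le_rfl one_pos` has the type of stub A up to `ζδ`-reduction
and the kernel accepts the term below with no rewriting.  Consequence for the route (lead's note,
D-0014): given the exact dictionary T (`stub_affineTransport`, provable) the crux `ModulusUniversality`
is implied by `BrickWallFlow` (at the single parameter `t = 0`) together with stub C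
(`stub_conventionRobustness`); stub A carries no content beyond the route's own crux #4.

Nothing here closes an item: stub A itself (hence `BrickWallFlow` at `t = 0`) is the open
universality statement.
-/

noncomputable section

open MeasureTheory Filter Topology
open Literature.Probability.LatticeModels
open Literature.Probability.RandomPlanarGeometry

namespace Summit.CriticalPhenomena.SAWScalingLimit.Cruxes.ModulusUniversality.Birth

/-- **Stub A of line `birth` from the route crux `BrickWallFlow`.**  The registered signature of
`stub_brickWallComparison` (tree vocabulary, lead reshape 1) is the specialisation `t = 0` of
`SAWBrickWallHomotopy.BrickWallFlow`, by `rfl` after `ζ`-reducing the item's `let`s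
(`nodd = SAW.oddVerticalCount`, `xc = SAW.criticalFugacityT 0`, `P = SAW.brickWallLaw · · 0`).
[folklore] -/
theorem stub_brickWallComparison_of_brickWallFlow :
    Summit.CriticalPhenomena.SAWScalingLimit.Theses.SAWBrickWallHomotopy.BrickWallFlow →
    ∃ ρ₁ ρ₂ : ℝ, 0 < ρ₁ ∧ 0 < ρ₂ ∧ ∀ Ψ : ℂ ≃ₜ ℂ,
      (∀ z : ℂ, Ψ z = ((ρ₁ * z.re : ℝ) : ℂ) + ((ρ₂ * z.im : ℝ) : ℂ) * Complex.I) →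
      ∀ (D : DobrushinDomain) (a b : ℝ → Site 2), SAW.IsEndpointApprox D a b →
        ∃ a' b' : ℝ → Site 2, SAW.IsEndpointApprox (D.map Ψ.symm) a' b' ∧
          (∀ᶠ δ in nhdsWithin 0 (Set.Ioi 0),
            IsProbabilityMeasure (SAW.brickWallLaw (D.map Ψ.symm).carrier δ 0 (a' δ) (b' δ))) ∧
          ∀ f : BoundedContinuousFunction (CurveClass ℂ) ℝ,
            Tendsto (fun δ => (∫ γ, f γ.curve ∂(SAW.law D.carrier δ (a δ) (b δ))) -
              ∫ γ, f (CurveClass.map (Ψ : C(ℂ, ℂ)) γ.curve)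
                ∂(SAW.brickWallLaw (D.map Ψ.symm).carrier δ 0 (a' δ) (b' δ)))
              (nhdsWithin 0 (Set.Ioi 0)) (nhds 0) :=
  fun h => h 0 le_rfl one_pos

/-- The same reduction with the route item's inlined `let`s made explicit on the brick-wall side:
`BrickWallFlow` at any admissible `t` is the statement about the tree's `SAW.brickWallLaw · · t`
(so the whole homotopy, not only its `t = 0` end, is available in tree vocabulary). [folklore] -/
theorem brickWallFlow_iff_brickWallLaw :
    Summit.CriticalPhenomena.SAWScalingLimit.Theses.SAWBrickWallHomotopy.BrickWallFlow ↔
    ∀ t : ℝ, 0 ≤ t → t < 1 →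
      ∃ r₁ r₂ : ℝ, 0 < r₁ ∧ 0 < r₂ ∧ ∀ Φ : ℂ ≃ₜ ℂ,
        (∀ z : ℂ, Φ z = ((r₁ * z.re : ℝ) : ℂ) + ((r₂ * z.im : ℝ) : ℂ) * Complex.I) →
        ∀ (D : DobrushinDomain) (a b : ℝ → Site 2), SAW.IsEndpointApprox D a b →
          ∃ a' b' : ℝ → Site 2, SAW.IsEndpointApprox (D.map Φ.symm) a' b' ∧
            (∀ᶠ δ in nhdsWithin 0 (Set.Ioi 0),
              IsProbabilityMeasure (SAW.brickWallLaw (D.map Φ.symm).carrier δ t (a' δ) (b' δ))) ∧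
            ∀ f : BoundedContinuousFunction (CurveClass ℂ) ℝ,
              Tendsto (fun δ => (∫ γ, f γ.curve ∂(SAW.law D.carrier δ (a δ) (b δ))) -
                ∫ γ, f (CurveClass.map (Φ : C(ℂ, ℂ)) γ.curve)
                  ∂(SAW.brickWallLaw (D.map Φ.symm).carrier δ t (a' δ) (b' δ)))
                (nhdsWithin 0 (Set.Ioi 0)) (nhds 0) :=
  Iff.rfl

end Summit.CriticalPhenomena.SAWScalingLimit.Cruxes.ModulusUniversality.Birth

end
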